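import Mathlib
import Literature.MathematicalPhysics.QuantumManyBody.PeriodicBoseGasFourier
import HarnessLib

/-!
# The ball multiplier of the torus plane waves

Helper for item stmt-AtomisticToContinuum-9002 (`BallCriterion`, route BECSubharmonicContinuation):
for the plane waves `e_p(y) = exp(2πi p·y/L)` of the torus of side `L` and the ball `B = B(0, L/2)`,
`Re ⨍_B e_p ≤ 1/2` for every `p ≠ 0` (the sharp value is `3 j₁(π|p|)/(π|p|) ≤ 3/π²`; we prove the
cruder `|⨍_B e_p| ≤ 3/(2π)` by integrating first along an axis `j` with `p_j ≠ 0`, where every chord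
contributes at most `2/|k_j| = L/(π|p_j|)`, and the chords are indexed by a disc of area `π(L/2)²`).
-/

noncomputable section

open MeasureTheory Filter Set WithLp Complex Metric
open scoped ENNReal NNReal ComplexConjugate

namespace Summit.AtomisticToContinuum.BoseEinsteinCondensation.Theorems

open Literature.MathematicalPhysics.QuantumManyBody.BoseGas

/-- **One chord**: `‖∫_{-ρ}^{ρ} e^{i a t} dt‖ ≤ 2/|a|` for real `a ≠ 0`. [folklore] -/
theorem norm_integral_exp_mul_I_le {a : ℝ} (ha : a ≠ 0) (ρ : ℝ) :
    ‖∫ t in (-ρ)..ρ, Complex.exp ((a : ℂ) * I * t)‖ ≤ 2 / |a| := by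
  have hc : ((a : ℂ) * I) ≠ 0 := mul_ne_zero (Complex.ofReal_ne_zero.2 ha) Complex.I_ne_zero
  rw [integral_exp_mul_complex hc, norm_div]
  have hnc : ‖(a : ℂ) * I‖ = |a| := by simp
  rw [hnc]
  gcongr
  calc ‖Complex.exp (↑a * I * ↑ρ) - Complex.exp (↑a * I * ↑(-ρ))‖
      ≤ ‖Complex.exp (↑a * I * ↑ρ)‖ + ‖Complex.exp (↑a * I * ↑(-ρ))‖ := norm_sub_le _ _
    _ = 1 + 1 := by
        rw [show (a : ℂ) * I * (ρ : ℂ) = ((a * ρ : ℝ) : ℂ) * I by push_cast; ring,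
          Complex.norm_exp_ofReal_mul_I,
          show (a : ℂ) * I * ((-ρ : ℝ) : ℂ) = ((a * (-ρ) : ℝ) : ℂ) * I by push_cast; ring,
          Complex.norm_exp_ofReal_mul_I]
    _ = 2 := by norm_num

/-- The coordinate disc `{w | w₀² + w₁² < R²} ⊂ ℝ²` is the pull-back of the Euclidean disc. [folklore] -/
theorem disc_eq_preimage_ball {R : ℝ} (hR : 0 ≤ R) :
    {w : Fin 2 → ℝ | ∑ k, w k ^ 2 < R ^ 2} = (toLp 2) ⁻¹' ball (0 : EuclideanSpace ℝ (Fin 2)) R := by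
  ext w
  simp only [mem_setOf_eq, mem_preimage, mem_ball_zero_iff, EuclideanSpace.norm_eq,
    Real.norm_eq_abs, sq_abs]
  rw [Real.sqrt_lt (Finset.sum_nonneg fun k _ => sq_nonneg _) hR]

/-- The coordinate disc is measurable. [folklore] -/
theorem measurableSet_disc (R : ℝ) : MeasurableSet {w : Fin 2 → ℝ | ∑ k, w k ^ 2 < R ^ 2} :=
  measurableSet_lt (by fun_prop) measurable_const

/-- The coordinate disc `{w ∈ ℝ² | w₀² + w₁² < R²}` has area `π R²`. [folklore] -/
theorem volume_real_disc {R : ℝ} (hR : 0 ≤ R) :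
    (volume : Measure (Fin 2 → ℝ)).real {w | ∑ k, w k ^ 2 < R ^ 2} = Real.pi * R ^ 2 := by
  rw [disc_eq_preimage_ball hR, measureReal_def,
    (PiLp.volume_preserving_toLp (Fin 2)).measure_preimage measurableSet_ball.nullMeasurableSet,
    EuclideanSpace.volume_ball_fin_two, ENNReal.toReal_mul, ENNReal.toReal_pow,
    ENNReal.toReal_ofReal hR, ENNReal.toReal_ofReal Real.pi_pos.le, mul_comm]

/-- **The ball integral of a non-constant plane wave**: `‖∫_{B(0,L/2)} e_p‖ ≤ L³/4` for `p ≠ 0`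
(slice along an axis `j` with `p_j ≠ 0`: each chord gives at most `L/(π|p_j|) ≤ L/π`, the chords
are indexed by a disc of area `π L²/4`). [folklore] -/
theorem norm_setIntegral_ball_cellWave_le {L : ℝ} (hL : 0 < L) {p : Fin 3 → ℤ} (hp : p ≠ 0) :
    ‖∫ y in ball (0 : Space) (L / 2), cellWave L p y‖ ≤ L ^ 3 / 4 := by
  obtain ⟨j, hj⟩ : ∃ j, p j ≠ 0 := Function.ne_iff.1 hp
  set R : ℝ := L / 2 with hR
  have hR0 : 0 < R := by positivity
  -- (a) to coordinates `Fin 3 → ℝ`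
  set T : Set (Fin 3 → ℝ) := (toLp 2) ⁻¹' ball (0 : Space) R with hT
  have hTm : MeasurableSet T := measurableSet_ball.preimage (WithLp.measurable_toLp 2 _)
  have hTvol : volume T = volume (ball (0 : Space) R) :=
    (PiLp.volume_preserving_toLp (Fin 3)).measure_preimage measurableSet_ball.nullMeasurableSet
  have h1 : ∫ y in ball (0 : Space) R, cellWave L p y = ∫ u in T, cellWave L p (toLp 2 u) :=
    ((PiLp.volume_preserving_toLp (Fin 3)).setIntegral_preimage_emb
      (MeasurableEquiv.toLp 2 (Fin 3 → ℝ)).measurableEmbedding (cellWave L p) (ball 0 R)).symm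
  -- (b) split off the coordinate `j`
  set e := MeasurableEquiv.piFinSuccAbove (fun _ : Fin 3 => ℝ) j with he
  have hmp : MeasurePreserving e.symm (volume.prod volume) volume :=
    (volume_preserving_piFinSuccAbove (fun _ : Fin 3 => ℝ) j).symm
  have hesymm : ∀ z : ℝ × (Fin 2 → ℝ), e.symm z = Fin.insertNth (α := fun _ => ℝ) j z.1 z.2 := by
    intro z
    rw [he, MeasurableEquiv.piFinSuccAbove_symm_apply]
    funext k
    exact Fin.insertNthEquiv_apply _ _ _ _
  set S : Set (ℝ × (Fin 2 → ℝ)) := e.symm ⁻¹' T with hS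
  have hSm : MeasurableSet S := hTm.preimage e.symm.measurable
  have hSvol : (volume.prod volume) S = volume (ball (0 : Space) R) := by
    rw [hS, hmp.measure_preimage hTm.nullMeasurableSet, hTvol]
  have h2 : ∫ u in T, cellWave L p (toLp 2 u) =
      ∫ z in S, cellWave L p (toLp 2 (e.symm z)) ∂(volume.prod volume) :=
    (hmp.setIntegral_preimage_emb e.symm.measurableEmbedding
      (fun u => cellWave L p (toLp 2 u)) T).symm
  -- membership in `S`
  have hmemS : ∀ (t : ℝ) (w : Fin 2 → ℝ), (t, w) ∈ S ↔ t ^ 2 + ∑ k, w k ^ 2 < R ^ 2 := by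
    intro t w
    simp only [hS, hT, mem_preimage, hesymm, mem_ball_zero_iff, EuclideanSpace.norm_eq,
      Real.norm_eq_abs, sq_abs]
    rw [Fin.sum_univ_succAbove _ j, Fin.insertNth_apply_same]
    simp only [Fin.insertNth_apply_succAbove]
    exact Real.sqrt_lt' hR0
  -- the integrand factorises
  set a : ℝ := 2 * Real.pi * (p j : ℝ) / L with ha
  have ha0 : a ≠ 0 := by
    rw [ha]
    exact div_ne_zero (mul_ne_zero (by positivity) (Int.cast_ne_zero.2 hj)) hL.ne'
  have ha1 : 2 / |a| ≤ L / Real.pi := by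
    have hpj : (1 : ℝ) ≤ |(p j : ℝ)| := by
      rw [← Int.cast_abs]; exact_mod_cast Int.one_le_abs hj
    have habs : |a| = 2 * Real.pi * |(p j : ℝ)| / L := by
      rw [ha, abs_div, abs_mul, abs_of_pos (by positivity : (0 : ℝ) < 2 * Real.pi), abs_of_pos hL]
    have hlow : 2 * Real.pi / L ≤ |a| := by
      rw [habs]
      exact div_le_div_of_nonneg_right (le_mul_of_one_le_right (by positivity) hpj) hL.le
    calc 2 / |a| ≤ 2 / (2 * Real.pi / L) :=
          div_le_div_of_nonneg_left (by norm_num) (by positivity) hlow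
      _ = L / Real.pi := by field_simp
  set K : (Fin 2 → ℝ) → ℂ := fun w =>
    Complex.exp (2 * Real.pi * I * (∑ k, (p (j.succAbove k) : ℝ) * w k) / L) with hK
  have hK1 : ∀ w, ‖K w‖ = 1 := by
    intro w
    rw [hK]
    simp only
    rw [show (2 * Real.pi * I * ((∑ k, (p (j.succAbove k) : ℝ) * w k : ℝ) : ℂ) / (L : ℂ)) =
      ((2 * Real.pi * (∑ k, (p (j.succAbove k) : ℝ) * w k) / L : ℝ) : ℂ) * I by push_cast; ring,
      Complex.norm_exp_ofReal_mul_I]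
  have hKc : Continuous K := by
    rw [hK]
    fun_prop
  have hfac : ∀ (t : ℝ) (w : Fin 2 → ℝ),
      cellWave L p (toLp 2 (e.symm (t, w))) = Complex.exp ((a : ℂ) * I * t) * K w := by
    intro t w
    rw [cellWave_apply, hesymm, hK, ← Complex.exp_add]
    congr 1
    simp only
    rw [Fin.sum_univ_succAbove _ j, Fin.insertNth_apply_same]
    simp only [Fin.insertNth_apply_succAbove]
    rw [ha]
    push_cast
    ring
  -- (c) indicator form and Fubini, chords innermost
  set F : ℝ × (Fin 2 → ℝ) → ℂ := S.indicator fun z => Complex.exp ((a : ℂ) * I * z.1) * K z.2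
    with hF
  have hGc : Continuous fun z : ℝ × (Fin 2 → ℝ) => Complex.exp ((a : ℂ) * I * z.1) * K z.2 := by
    fun_prop
  have h3 : ∫ z in S, cellWave L p (toLp 2 (e.symm z)) ∂(volume.prod volume) =
      ∫ z, F z ∂(volume.prod volume) := by
    rw [hF, integral_indicator hSm]
    refine integral_congr_ae (Eventually.of_forall fun z => ?_)
    rcases z with ⟨t, w⟩
    exact hfac t w
  have hFint : Integrable F (volume.prod volume) := by
    rw [hF, integrable_indicator_iff hSm]
    refine Measure.integrableOn_of_bounded (M := 1) ?_ hGc.aestronglyMeasurable ?_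
    · rw [hSvol]; exact measure_ball_lt_top.ne
    · refine Eventually.of_forall fun z => ?_
      rw [norm_mul, hK1, mul_one, show (a : ℂ) * I * (z.1 : ℂ) = ((a * z.1 : ℝ) : ℂ) * I by
        push_cast; ring, Complex.norm_exp_ofReal_mul_I]
  have h4 : ∫ z, F z ∂(volume.prod volume) = ∫ w, ∫ t, F (t, w) := integral_prod_symm F hFint
  -- (d) each chord
  set D : Set (Fin 2 → ℝ) := {w | ∑ k, w k ^ 2 < R ^ 2} with hD
  have hDm : MeasurableSet D := measurableSet_disc R
  have hchord : ∀ w, ‖∫ t, F (t, w)‖ ≤ D.indicator (fun _ => 2 / |a|) w := by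
    intro w
    by_cases hw : w ∈ D
    · rw [indicator_of_mem hw]
      have hw' : ∑ k, w k ^ 2 < R ^ 2 := hw
      set r : ℝ := R ^ 2 - ∑ k, w k ^ 2 with hr
      have hr0 : 0 < r := by rw [hr]; linarith
      set ρ : ℝ := Real.sqrt r with hρ
      have hρ0 : 0 < ρ := Real.sqrt_pos.2 hr0
      have hFw : (fun t => F (t, w)) =
          (Ioo (-ρ) ρ).indicator fun t => Complex.exp ((a : ℂ) * I * t) * K w := by
        funext t
        have hiff : (t, w) ∈ S ↔ t ∈ Ioo (-ρ) ρ := by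
          rw [hmemS, mem_Ioo, hρ, ← Real.sq_lt, hr]
          constructor <;> intro h <;> linarith
        by_cases ht : t ∈ Ioo (-ρ) ρ
        · rw [indicator_of_mem ht, hF, indicator_of_mem (hiff.2 ht)]
        · rw [indicator_of_notMem ht, hF, indicator_of_notMem (fun h => ht (hiff.1 h))]
      rw [hFw, integral_indicator measurableSet_Ioo, integral_mul_const, norm_mul, hK1, mul_one,
        ← integral_Ioc_eq_integral_Ioo, ← intervalIntegral.integral_of_le (by linarith)]
      exact norm_integral_exp_mul_I_le ha0 ρ
    · rw [indicator_of_notMem hw]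
      have hw' : R ^ 2 ≤ ∑ k, w k ^ 2 := not_lt.1 hw
      have hFw : (fun t => F (t, w)) = fun _ => 0 := by
        funext t
        rw [hF, indicator_of_notMem]
        rw [hmemS]
        nlinarith [sq_nonneg t]
      rw [hFw, integral_zero, norm_zero]
  -- (e) sum over the chords
  have hDvol : volume.real D = Real.pi * R ^ 2 := volume_real_disc hR0.le
  have hDvol' : volume D = volume (ball (0 : EuclideanSpace ℝ (Fin 2)) R) := by
    rw [hD, disc_eq_preimage_ball hR0.le,
      (PiLp.volume_preserving_toLp (Fin 2)).measure_preimage measurableSet_ball.nullMeasurableSet]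
  have hgint : Integrable (D.indicator fun _ : Fin 2 → ℝ => 2 / |a|) volume := by
    refine IntegrableOn.integrable_indicator ?_ hDm
    refine integrableOn_const ?_
    rw [hDvol']
    exact measure_ball_lt_top.ne
  have h5 : ‖∫ w, ∫ t, F (t, w)‖ ≤ ∫ w, D.indicator (fun _ => 2 / |a|) w :=
    norm_integral_le_of_norm_le hgint (Eventually.of_forall hchord)
  have h6 : ∫ w, D.indicator (fun _ : Fin 2 → ℝ => 2 / |a|) w = Real.pi * R ^ 2 * (2 / |a|) := by
    rw [integral_indicator hDm, setIntegral_const, hDvol, smul_eq_mul]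
  -- (f) assemble
  rw [h1, h2, h3, h4]
  refine h5.trans ?_
  rw [h6]
  calc Real.pi * R ^ 2 * (2 / |a|) ≤ Real.pi * R ^ 2 * (L / Real.pi) := by gcongr
    _ = L ^ 3 / 4 := by rw [hR]; field_simp; ring

/-- `|B(0, L/2)| = π L³ / 6` in `ℝ³`. [folklore] -/
theorem volume_real_ball_half {L : ℝ} (hL : 0 < L) :
    (volume : Measure Space).real (ball (0 : Space) (L / 2)) = Real.pi * L ^ 3 / 6 := by
  rw [measureReal_def, EuclideanSpace.volume_ball_fin_three, ENNReal.toReal_mul, ENNReal.toReal_pow,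
    ENNReal.toReal_ofReal (by positivity), ENNReal.toReal_ofReal (by positivity)]
  ring

/-- **The ball multiplier is at most one half off the zero mode**:
`Re ⨍_{B(0,L/2)} e_p ≤ 1/2` for `p ≠ 0` (indeed `|⨍ e_p| ≤ 3/(2π)` and `π > 3`). [folklore] -/
theorem re_setAverage_ball_cellWave_le {L : ℝ} (hL : 0 < L) {p : Fin 3 → ℤ} (hp : p ≠ 0) :
    (⨍ y in ball (0 : Space) (L / 2), cellWave L p y).re ≤ 1 / 2 := by
  rw [setAverage_eq, volume_real_ball_half hL, Complex.smul_re, smul_eq_mul]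
  have hre := Complex.re_le_norm (∫ y in ball (0 : Space) (L / 2), cellWave L p y)
  have hn := norm_setIntegral_ball_cellWave_le hL hp
  have hpos : 0 < (Real.pi * L ^ 3 / 6)⁻¹ := by positivity
  calc (Real.pi * L ^ 3 / 6)⁻¹ * (∫ y in ball (0 : Space) (L / 2), cellWave L p y).re
      ≤ (Real.pi * L ^ 3 / 6)⁻¹ * (L ^ 3 / 4) := by
        exact mul_le_mul_of_nonneg_left (hre.trans hn) hpos.le
    _ = 3 / (2 * Real.pi) := by field_simp; ring
    _ ≤ 1 / 2 := by
        rw [div_le_div_iff₀ (by positivity) (by norm_num)]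
        nlinarith [Real.pi_gt_three]

/-- **The zero mode**: `⨍_{B(0,L/2)} e_0 = 1`. [folklore] -/
theorem setAverage_ball_cellWave_zero {L : ℝ} (hL : 0 < L) :
    (⨍ y in ball (0 : Space) (L / 2), cellWave L 0 y) = 1 := by
  simp only [cellWave_zero]
  rw [setAverage_const]
  · exact (measure_ball_pos volume _ (by positivity)).ne'
  · exact measure_ball_lt_top.ne

end Summit.AtomisticToContinuum.BoseEinsteinCondensation.Theorems

end
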